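import Summits.QuantumFields.YangMills.Theorems.BalabanUVNodesN21GappedRoadK3V6Knit
import Summits.QuantumFields.YangMills.Theorems.BalabanUVNodesN20KeyedRelWeightAtGappedReading

/-!
# BalabanUVNodes ∕ N20 (NE7b) — THE GAPPED ROAD AT THE ZERO CUT: N20 LEAVES THE BILL.  dag-n21-d g12's pin-free knit `spineGivenEndpointR13SepCoPHV_of_gapRoad` (K3⁸ from K4 +
# N20's WITNESS at the gapped carriers + N19′'s WITNESS at the gapped cores + node U5's Target off the live line, N21 ∕ N27x discharged) instantiated at the cut reading
# `jc ≡ 0`, where this seat's `relWeightBound_carriersGap₁₃_cutZero` (p630052) IS N20's witness — hypothesis-free; what remains displayed is K4, the dial rows, (H-ζ) on the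
# live line, node U5's Target off it, and N19′ = NE7 PROPER ON EVERY KEYED CLASS of the gapped cores

Cell `pub-ymgap` (HUMAN RULING D-0062 Track A; width push D-0149, director-ym №197), width seat `pub-ymgap-dag-n20-w2` (gen 5) on node N20 = NE7b; key item K3⁸
`SpineGivenEndpointR13SepCoPHV` = stmt-QuantumFields-27366 (KEY MAP v2); `--kind proof --supports … --as helper`; COUNT-NEUTRAL; LOCATED; CONDITIONAL (every remaining binder is a
HYPOTHESIS inhabited for no family today — K0⁷ `Record13SepCoPHInhabited` OPEN).  [LF-I] = [Balaban1989LargeFieldI], [LF-II] = [Balaban1989LargeFieldII].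

WHY.  n21-d's `…N21GappedRoadK3V6Knit` (§3) proves the route decl from SIX displayed binders on the gapped road: (H-ζ) on the live line, the dial rows `0 ≤ ρ ≤ 1`,
`Σ 1∕(n+1) < ∞`, K4 `KeyedRatesHolderD4V β rr`, ★ N20's WITNESS `∃ W, RelWeightBound 1 (classSet₁₃ θ 0 g₀) (gapWeightA₁₃ …) (gapWeightB₁₃ …) (badClass₁₃ θ 0 g₀ (jc …)) W` on the
live line, N19′'s WITNESS at the gapped cores (slot-keyed, prefixed), node U5's Target off the line.  The cut reading `jc` is free in that theorem.  At `jc ≡ 0` the persistence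
class is EMPTY (`badClass₁₃_cutZero`), N20's witness is `W := 0` (p630052 `relWeightBound_carriersGap₁₃_cutZero`, NO hypothesis — not even the live line), and N19′'s core is asked on
`classSet₁₃ θ 0 g₀ K ∖ ∅` = EVERY keyed class.  This file is that instantiation, BY NAME, so that the gapped road's bill reads without an N20 line:
* §1 `exists_relWeightBound_carriersGap₁₃_cutZero` (N20's witness binder of the knit, DISCHARGED at `jc ≡ 0` for every tuple) · `keyedRelWeight_of_gapPin_cutZero` (N20's v6 face
  on a reading pinned to `crGap₁₃V 2 0 ρ n` on the live line ∕ `crOneTerm₁₃ 0` off it — THEOREM) · `core_badClass₁₃_cutZero_of_allClasses` (NE7 proper on every keyed class ⇒ the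
  knit's `NE7.Core … (badClass₁₃ θ 0 g₀ (fun _ ↦ 0)) …` shape);
* §2 ★★★ `spineGivenEndpointR13SepCoPHV_of_gapRoad_cutZero` — K3⁸ from: (H-ζ) on the live line · the dial rows · K4 · N19′ = «∃ summable δ, for every `K` ONE constant `c` with
  `e^{c − vol·δ_K}·gapCoreA ≤ gapCoreB ≤ e^{c + vol·δ_K}·gapCoreA` on EVERY keyed class `x ∈ classSet₁₃ θ 0 g₀ K`, `|t| ≤ 1`» (slot-keyed, under (B) → END → `ForSmallCouplings` at
  the slot datum and `PHolderD4 β`) · node U5's Target off the live line — FIVE binders, N20 ∕ N21 ∕ N27x discharged BY NAME;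
* §3 ★★ `exists_gapPinned_faces_cutZero` — under a gap pin at `jc ≡ 0` there is a spine reading carrying ALL FOUR K5 faces of stub 2's body, THREE by theorem (N20 here, N21 ∕ N27x
  n21-d's), the fourth = the binder of §2.
WHAT IT SAYS (located, count-neutral): on the gapped road with the zero cut the crux's two-run content is ONE statement — the NE7 core edge between the two runs' GAPPED cores on
every keyed class of dag-n20-d's keys, with a summable rate (plan's v11 BOOKING (5) «with `jc := 0` three of stub 2's five conjuncts are estimate-free and the two-run content sits
in the core ∕ shell pair», now with the shell half a THEOREM on n21-d's road and the weight half a THEOREM here).  NOT `stub_expansion13HV` (its `PinnedAtLive` names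
`crOfRecord₁₃V`; a gap pin is the PLANNER's call); the N19′ binder is NE7 proper — NOT PRINTED for `d = 4`, NOT proved, inhabited for no family; node U5's Target off the live line
is the N27 lineage's declared device (dag-n20-w1 p597932 ∕ p598780).
Cited BY NAME, not re-typed: n21-d `…N21GappedRoadK3V6Knit` (`exists_reading_livePin`, `keyedRelWeight_of_gapPin_of_witness`, `keyedShellWeight_of_gapPin`, `keyedExtractionV_of_gapPin`,
`keyedCoreEdgeHolderD4V_of_gapPin_of_witness`, `spineGivenEndpointR13SepCoPHV_of_gapRoad`), `crGap₁₃V ∕ gapWeight∕gapCore{A,B}₁₃`; dag-n27-w1 `K3V5Defs ∕ K3V6Defs` (the v6 face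
texts); dag-n20-w1 `crOneTerm₁₃`; this seat p630052 `relWeightBound_carriersGap₁₃_cutZero`; g0 `badClass₁₃_cutZero`.

HONEST FRAMING.  Pure logic over named faces; NO estimate of Bałaban's asserted or used; every displayed binder of §2 is a HYPOTHESIS inhabited for no family today (K0⁷ OPEN);
NE7 ∕ NE7b ∕ NE7c NOT PRINTED for `d = 4`, NOT proved; N19 ∕ N20 ∕ N21 ∕ N27 NOT discharged (a face free at a dial is not a node discharge — dag-lead's rule); K3⁸ NOT claimed, NOT
closed (the registered stub 2 pins `crOfRecord₁₃V`); counts unmoved (typed 28∕28 · discharged 5∕27); no count claim.  One finite `𝕋⁴_{L^K}` programme at fixed `ε`, Bałaban AS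
PRINTED; the YM mass gap (Clay) is NOT proved by any of this — R4 closes the conditional finite-𝕋⁴ rung `BalabanLadder.UV` only; NOT ℝ⁴, NOT infinite volume, NOT OS.  No `def`, no
`instance`, no `notation`, no `sorry`.  Sources (locators, bookkeeping only): [LF-I] p.181; [LF-II] Thm 1 + (0.1) pp.355–356, (1.80) p.384; [King1986] (3.10)–(3.11) p.656.
-/

set_option autoImplicit false

noncomputable section

open scoped BigOperators

namespace Summit.QuantumFields.YangMills.BalabanUVNodes.N20GappedRoadCutZeroKnit

open Literature.MathematicalPhysics.QuantumFieldTheory.Balaban1983to89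
open Literature.MathematicalPhysics.QuantumFieldTheory.Balaban1983to89.T4Continuum
open Literature.MathematicalPhysics.QuantumFieldTheory.Balaban1983to89.Node00
open T4WeightBudget (RelWeightBound)
open T4ContinuumYM4Torus (ForSmallCouplings)
open Summit.QuantumFields.BalabanUV.T4Continuum.Spine
open YMDAG.UVSplit (SpineReading₁₃CoPH classSet₁₃ badClass₁₃)
open Summit.QuantumFields.YangMills.Theorems.K3V5Defs (SpineReading RateReadingFn CutReading KeyedRelWeight KeyedShellWeight LiveSel PHolderD4)
open Summit.QuantumFields.YangMills.Theorems.K3V6Defs (KeyedRatesHolderD4V KeyedCoreEdgeHolderD4V KeyedExtractionV)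
open Summit.QuantumFields.YangMills.BalabanUVNodes.N20OffLiveOneTermReading (crOneTerm₁₃)
open Summit.QuantumFields.YangMills.Theorems.N21ShellSplitOfRecord13CoPH (WidthLetter₁₃CoPH DepthLetter₁₃CoPH crGap₁₃V crGap₁₃VAt gapWeightA₁₃ gapWeightB₁₃ gapCoreA₁₃ gapCoreB₁₃)
open Summit.QuantumFields.YangMills.Theorems.N21GappedRoadK3V6Knit (exists_reading_livePin keyedRelWeight_of_gapPin_of_witness keyedShellWeight_of_gapPin
  keyedExtractionV_of_gapPin keyedCoreEdgeHolderD4V_of_gapPin_of_witness spineGivenEndpointR13SepCoPHV_of_gapRoad)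
open Summit.QuantumFields.YangMills.BalabanUVNodes.N20KeyedRelWeightAtGappedReading (relWeightBound_carriersGap₁₃_cutZero)
open Summit.QuantumFields.YangMills.BalabanUVNodes.N20KeyedRelWeightCutZero (badClass₁₃_cutZero)

/-! ## §1  N20's witness binder of the knit is DISCHARGED at the zero cut; the all-classes form of N19′'s binder -/

section Witness

variable (ρ : WidthLetter₁₃CoPH 2) (n : DepthLetter₁₃CoPH 2)

/-- **N20's WITNESS BINDER OF n21-d's KNIT, DISCHARGED AT THE ZERO CUT READING** — for EVERY Stage-13 tuple with core provisos (live or not, guards unused): the witness is `W := 0`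
(p630052 `relWeightBound_carriersGap₁₃_cutZero`; the persistence class `badClass₁₃ θ 0 g₀ (fun _ ↦ 0)` is empty). [cite: King1986, (3.10) p.656; Balaban1989LargeFieldII, (1.80) p.384 (bookkeeping)] -/
theorem exists_relWeightBound_carriersGap₁₃_cutZero :
    ∀ (F : T4Family) (θ : Stage13HParams F 2) (hP : θ.Provisos₁₃CoPH F 2), ((θ.ZhUnity F 2 ∧ θ.SlotsNondegenerate₁₃ F 2) ∧ LiveSel F θ) → θ.Admissible F 2 →
      ∀ (g₀ : ℕ → ℝ) (os : List (ULoop F)),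
        ∃ W : ℕ → ℝ, RelWeightBound 1 (classSet₁₃ θ 0 g₀) (gapWeightA₁₃ θ hP 0 g₀ os (ρ F θ hP g₀ os) (n F θ hP g₀ os))
          (gapWeightB₁₃ θ hP 0 g₀ os (ρ F θ hP g₀ os) (n F θ hP g₀ os)) (badClass₁₃ θ 0 g₀ ((fun _ _ _ _ _ _ => 0 : CutReading) F θ hP g₀ os)) W :=
  fun _ θ hP _ _ g₀ os => ⟨fun _ => 0, relWeightBound_carriersGap₁₃_cutZero θ hP 0 g₀ os _ _⟩

/-- **N20's v6 FACE ON A READING GAP-PINNED AT THE ZERO CUT IS A THEOREM**: `KeyedRelWeight cr` for `cr` pinned to `crGap₁₃V 2 0 ρ n` on the live line and to `crOneTerm₁₃ 0` off it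
(n21-d's `keyedRelWeight_of_gapPin_of_witness` at §1's witness; off the line dag-n20-w1's `relWeightBound_crOneTerm₁₃`). [cite: King1986, (3.10) p.656; Balaban1989LargeFieldII, Thm 1 + (0.1) pp.355–356 (bookkeeping)] -/
theorem keyedRelWeight_of_gapPin_cutZero {cr : SpineReading}
    (hon : ∀ (F : T4Family) (θ : Stage13HParams F 2) (hP : θ.Provisos₁₃CoPH F 2) (g₀ : ℕ → ℝ) (os : List (ULoop F)),
      LiveSel F θ → cr F θ hP g₀ os = crGap₁₃V 2 ((fun _ _ _ _ _ _ => 0 : CutReading) F θ hP g₀ os) ρ n F θ hP g₀ os)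
    (hoff : ∀ (F : T4Family) (θ : Stage13HParams F 2) (hP : θ.Provisos₁₃CoPH F 2) (g₀ : ℕ → ℝ) (os : List (ULoop F)),
      ¬ LiveSel F θ → cr F θ hP g₀ os = crOneTerm₁₃ 0 F θ hP g₀ os) :
    KeyedRelWeight cr :=
  keyedRelWeight_of_gapPin_of_witness _ ρ n hon hoff (exists_relWeightBound_carriersGap₁₃_cutZero ρ n)

/-- **NE7 PROPER ON EVERY KEYED CLASS ⇒ THE KNIT's `NE7.Core` SHAPE AT THE ZERO CUT** (whose good class `classSet₁₃ … K ∖ badClass₁₃ … (fun _ ↦ 0) K t` IS the class set): a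
one-line repackaging, any carriers `P Q`, any decidability instance. [cite: Balaban1989LargeFieldII, Thm 1 + (0.1) pp.355–356 (bookkeeping)] -/
theorem core_badClass₁₃_cutZero_of_allClasses {F : T4Family} [DecidableEq (Σ K, SiteSeqKey F (0 + K))] (θ : Stage13HParams F 2) (g₀ : ℕ → ℝ) {vol : ℝ}
    {P Q : ℕ → ℝ → (Σ K, SiteSeqKey F (0 + K)) → ℝ} {δ : ℕ → ℝ}
    (h : ∀ K : ℕ, ∃ c : ℝ, ∀ t : ℝ, |t| ≤ 1 → ∀ x ∈ classSet₁₃ θ 0 g₀ K,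
      Real.exp (c - vol * δ K) * P K t x ≤ Q K t x ∧ Q K t x ≤ Real.exp (c + vol * δ K) * P K t x) :
    NE7.Core 1 vol (classSet₁₃ θ 0 g₀) (badClass₁₃ θ 0 g₀ (fun _ => 0)) P Q δ := fun K => by
  obtain ⟨c, hc⟩ := h K
  exact ⟨c, fun t ht x hx => hc t ht x (Finset.mem_sdiff.1 hx).1⟩

end Witness

/-! ## §2  K3⁸ on the gapped road at the zero cut — N20, N21, N27x discharged BY NAME; N19′ = NE7 proper on every keyed class of the gapped cores -/

section Knit

/-- ★★★ **K3⁸ ON THE GAPPED ROAD AT THE ZERO CUT, PIN-FREE — FIVE DISPLAYED BINDERS, NO N20 LINE.**  Binder by binder: (H-ζ) `ZetaMeasurable` on the guarded admissible tuples of the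
live-selector line; the dial rows `0 ≤ ρ ≤ 1`, `Σ_K 1∕(n_K+1) < ∞`; K4 `KeyedRatesHolderD4V β rr`; N19′ = for every slot `v`, under (B) → END → `ForSmallCouplings` at the slot datum and
`PHolderD4 β`, «∃ summable `δ`, for every `K` ONE constant `c` with `e^{c − vol·δ_K}·gapCoreA ≤ gapCoreB ≤ e^{c + vol·δ_K}·gapCoreA` on EVERY keyed class `x ∈ classSet₁₃ θ 0 g₀ K`, `|t| ≤ 1`»
(NE7 proper between the two runs' GAPPED cores, NOT PRINTED for `d = 4`); node U5's Target at the datum off the live line.  N20's witness is THIS SEAT's zero-cut theorem, N21 ∕ N27x are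
n21-d's theorems (inside `spineGivenEndpointR13SepCoPHV_of_gapRoad`).  CONDITIONAL: every binder a HYPOTHESIS inhabited for no family (K0⁷ OPEN); NOT `stub_expansion13HV`; K3⁸ NOT
claimed. [cite: Balaban1989LargeFieldII, Thm 1 + (0.1) pp.355–356, (1.80) p.384; Balaban1989LargeFieldI, p.181; King1986, (3.10)–(3.11) p.656 (bookkeeping)] -/
theorem spineGivenEndpointR13SepCoPHV_of_gapRoad_cutZero (β : ℝ) (rr : RateReadingFn) (ρ : WidthLetter₁₃CoPH 2) (n : DepthLetter₁₃CoPH 2)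
    (hζm : ∀ (F : T4Family) (θ : Stage13HParams F 2), θ.Provisos₁₃CoPH F 2 → ((θ.ZhUnity F 2 ∧ θ.SlotsNondegenerate₁₃ F 2) ∧ LiveSel F θ) → θ.Admissible F 2 →
      ZetaMeasurable F 2 θ.ζ)
    (hρ : ∀ (F : T4Family) (θ : Stage13HParams F 2) (hP : θ.Provisos₁₃CoPH F 2) (g₀ : ℕ → ℝ) (os : List (ULoop F)) (K : ℕ),
      0 ≤ ρ F θ hP g₀ os K ∧ ρ F θ hP g₀ os K ≤ 1)
    (hn : ∀ (F : T4Family) (θ : Stage13HParams F 2) (hP : θ.Provisos₁₃CoPH F 2) (g₀ : ℕ → ℝ) (os : List (ULoop F)),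
      Summable (fun K => 1 / ((n F θ hP g₀ os K : ℝ) + 1)))
    (hr : KeyedRatesHolderD4V β rr)
    (h19 : ∀ (F : T4Family) (θ : Stage13HParams F 2) (h : θ.Provisos₁₃SepCoPH F 2) (v : Revision₁₃ F 2 θ h),
      ((θ.ZhUnity F 2 ∧ θ.SlotsNondegenerate₁₃ F 2) ∧ LiveSel F θ) → θ.Admissible F 2 →
      B16.EndStatementBPrinted (datumOfRecord₁₃SepCoPHV F 2 θ h v).C → DagBinding.EndpointExistence (datumOfRecord₁₃SepCoPHV F 2 θ h v).C.toB12 →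
        ForSmallCouplings (datumOfRecord₁₃SepCoPHV F 2 θ h v) fun g₀ => ∀ os : List (ULoop F),
          PHolderD4 β (datumOfRecord₁₃SepCoPHV F 2 θ h v) (rr F θ h.toCore g₀ os) →
            ∃ δ : ℕ → ℝ, (∀ K : ℕ, ∃ c : ℝ, ∀ t : ℝ, |t| ≤ 1 → ∀ x ∈ classSet₁₃ θ 0 g₀ K,
              Real.exp (c - F.side ^ 4 * δ K) * gapCoreA₁₃ θ h.toCore 0 g₀ os (ρ F θ h.toCore g₀ os) (n F θ h.toCore g₀ os) K t x ≤
                  gapCoreB₁₃ θ h.toCore 0 g₀ os (ρ F θ h.toCore g₀ os) (n F θ h.toCore g₀ os) K t x ∧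
                gapCoreB₁₃ θ h.toCore 0 g₀ os (ρ F θ h.toCore g₀ os) (n F θ h.toCore g₀ os) K t x ≤
                  Real.exp (c + F.side ^ 4 * δ K) * gapCoreA₁₃ θ h.toCore 0 g₀ os (ρ F θ h.toCore g₀ os) (n F θ h.toCore g₀ os) K t x) ∧ Summable δ)
    (htarget : ∀ (F : T4Family) (θ : Stage13HParams F 2) (hP : θ.Provisos₁₃CoPH F 2), ((θ.ZhUnity F 2 ∧ θ.SlotsNondegenerate₁₃ F 2) ∧ ¬ LiveSel F θ) → θ.Admissible F 2 →
      ∀ (g₀ : ℕ → ℝ) (os : List (ULoop F)), PHolderD4 β (datumOfRecord₁₃CoPH F 2 θ hP) (rr F θ hP g₀ os) →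
        ∃ δ : ℕ → ℝ, NE7.Target ((F.side : ℝ) ^ 4) 1 δ (fun K => T4GenFunBounds.schemeZ ((datumOfRecord₁₃CoPH F 2 θ hP).scheme g₀) os (0 + K))) :
    Summit.QuantumFields.YangMills.Theses.BalabanUVNodes.SpineGivenEndpointR13SepCoPHV := by
  refine spineGivenEndpointR13SepCoPHV_of_gapRoad β rr (fun _ _ _ _ _ _ => 0) ρ n hζm hρ hn hr (exists_relWeightBound_carriersGap₁₃_cutZero ρ n)
    (fun F θ h v hG hθ hB hE => ?_) htarget
  refine ForSmallCouplings.mono (fun g₀ h' os hPr => ?_) (h19 F θ h v hG hθ hB hE)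
  obtain ⟨δ, hδ, hsum⟩ := h' os hPr
  letI : DecidableEq (Σ K, SiteSeqKey F (0 + K)) := Classical.decEq _
  exact ⟨δ, core_badClass₁₃_cutZero_of_allClasses θ g₀ hδ, hsum⟩

end Knit

/-! ## §3  What stub 2 would read under a gap pin at the zero cut: all four faces, three by theorem -/

section Faces

/-- ★★ **UNDER A GAP PIN AT THE ZERO CUT THERE IS A SPINE READING CARRYING ALL FOUR K5 FACES OF STUB 2's BODY — THREE BY THEOREM** (N20: this seat's zero-cut witness; N21 ∕ N27x:
n21-d's), the fourth (N19′) from the all-classes NE7 core binder of §2 + node U5's Target off the live line; rows (H-ζ), dials.  The registered pin is the plan's; this is the kernel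
form of the alternative at `jc ≡ 0`, nothing more. [cite: Balaban1989LargeFieldII, Thm 1 + (0.1) pp.355–356, (1.80) p.384; King1986, (3.10)–(3.11) p.656 (bookkeeping)] -/
theorem exists_gapPinned_faces_cutZero (β : ℝ) (rr : RateReadingFn) (ρ : WidthLetter₁₃CoPH 2) (n : DepthLetter₁₃CoPH 2)
    (hζm : ∀ (F : T4Family) (θ : Stage13HParams F 2), θ.Provisos₁₃CoPH F 2 → ((θ.ZhUnity F 2 ∧ θ.SlotsNondegenerate₁₃ F 2) ∧ LiveSel F θ) → θ.Admissible F 2 →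
      ZetaMeasurable F 2 θ.ζ)
    (hρ : ∀ (F : T4Family) (θ : Stage13HParams F 2) (hP : θ.Provisos₁₃CoPH F 2) (g₀ : ℕ → ℝ) (os : List (ULoop F)) (K : ℕ),
      0 ≤ ρ F θ hP g₀ os K ∧ ρ F θ hP g₀ os K ≤ 1)
    (hn : ∀ (F : T4Family) (θ : Stage13HParams F 2) (hP : θ.Provisos₁₃CoPH F 2) (g₀ : ℕ → ℝ) (os : List (ULoop F)),
      Summable (fun K => 1 / ((n F θ hP g₀ os K : ℝ) + 1)))
    (h19 : ∀ (F : T4Family) (θ : Stage13HParams F 2) (h : θ.Provisos₁₃SepCoPH F 2) (v : Revision₁₃ F 2 θ h),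
      ((θ.ZhUnity F 2 ∧ θ.SlotsNondegenerate₁₃ F 2) ∧ LiveSel F θ) → θ.Admissible F 2 →
      B16.EndStatementBPrinted (datumOfRecord₁₃SepCoPHV F 2 θ h v).C → DagBinding.EndpointExistence (datumOfRecord₁₃SepCoPHV F 2 θ h v).C.toB12 →
        ForSmallCouplings (datumOfRecord₁₃SepCoPHV F 2 θ h v) fun g₀ => ∀ os : List (ULoop F),
          PHolderD4 β (datumOfRecord₁₃SepCoPHV F 2 θ h v) (rr F θ h.toCore g₀ os) →
            ∃ δ : ℕ → ℝ, (∀ K : ℕ, ∃ c : ℝ, ∀ t : ℝ, |t| ≤ 1 → ∀ x ∈ classSet₁₃ θ 0 g₀ K,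
              Real.exp (c - F.side ^ 4 * δ K) * gapCoreA₁₃ θ h.toCore 0 g₀ os (ρ F θ h.toCore g₀ os) (n F θ h.toCore g₀ os) K t x ≤
                  gapCoreB₁₃ θ h.toCore 0 g₀ os (ρ F θ h.toCore g₀ os) (n F θ h.toCore g₀ os) K t x ∧
                gapCoreB₁₃ θ h.toCore 0 g₀ os (ρ F θ h.toCore g₀ os) (n F θ h.toCore g₀ os) K t x ≤
                  Real.exp (c + F.side ^ 4 * δ K) * gapCoreA₁₃ θ h.toCore 0 g₀ os (ρ F θ h.toCore g₀ os) (n F θ h.toCore g₀ os) K t x) ∧ Summable δ)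
    (htarget : ∀ (F : T4Family) (θ : Stage13HParams F 2) (hP : θ.Provisos₁₃CoPH F 2), ((θ.ZhUnity F 2 ∧ θ.SlotsNondegenerate₁₃ F 2) ∧ ¬ LiveSel F θ) → θ.Admissible F 2 →
      ∀ (g₀ : ℕ → ℝ) (os : List (ULoop F)), PHolderD4 β (datumOfRecord₁₃CoPH F 2 θ hP) (rr F θ hP g₀ os) →
        ∃ δ : ℕ → ℝ, NE7.Target ((F.side : ℝ) ^ 4) 1 δ (fun K => T4GenFunBounds.schemeZ ((datumOfRecord₁₃CoPH F 2 θ hP).scheme g₀) os (0 + K))) :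
    ∃ cr : SpineReading,
      (∀ (F : T4Family) (θ : Stage13HParams F 2) (hP : θ.Provisos₁₃CoPH F 2) (g₀ : ℕ → ℝ) (os : List (ULoop F)),
        LiveSel F θ → cr F θ hP g₀ os = crGap₁₃V 2 (fun _ => 0) ρ n F θ hP g₀ os) ∧
      (∀ (F : T4Family) (θ : Stage13HParams F 2) (hP : θ.Provisos₁₃CoPH F 2) (g₀ : ℕ → ℝ) (os : List (ULoop F)),
        ¬ LiveSel F θ → cr F θ hP g₀ os = crOneTerm₁₃ 0 F θ hP g₀ os) ∧
      KeyedRelWeight cr ∧ KeyedShellWeight cr ∧ KeyedExtractionV cr ∧ KeyedCoreEdgeHolderD4V β cr rr := by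
  obtain ⟨cr, hon, hoff⟩ := exists_reading_livePin (fun F θ hP g₀ os => crGap₁₃V 2 ((fun _ _ _ _ _ _ => 0 : CutReading) F θ hP g₀ os) ρ n F θ hP g₀ os)
  refine ⟨cr, hon, hoff, keyedRelWeight_of_gapPin_cutZero ρ n hon hoff, keyedShellWeight_of_gapPin _ ρ n hon hoff hζm hρ hn,
    keyedExtractionV_of_gapPin _ ρ n hon hoff hζm, keyedCoreEdgeHolderD4V_of_gapPin_of_witness _ ρ n hon hoff hζm β rr hρ hn (fun F θ h v hG hθ hB hE => ?_) htarget⟩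
  refine ForSmallCouplings.mono (fun g₀ h' os hPr => ?_) (h19 F θ h v hG hθ hB hE)
  obtain ⟨δ, hδ, hsum⟩ := h' os hPr
  letI : DecidableEq (Σ K, SiteSeqKey F (0 + K)) := Classical.decEq _
  exact ⟨δ, core_badClass₁₃_cutZero_of_allClasses θ g₀ hδ, hsum⟩

end Faces

end Summit.QuantumFields.YangMills.BalabanUVNodes.N20GappedRoadCutZeroKnit

end
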